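import Mathlib.MeasureTheory.Integral.IntervalIntegral.FundThmCalculus
import Summits.NavierStokesRegularity.NavierStokesRegularity.Theorems.SelfMixingDichotomyCoherentScaleExclusionLoadFloorTools
import Summits.NavierStokesRegularity.NavierStokesRegularity.Theorems.SelfMixingDichotomyMixingPayoffWindowRegularity
import Summits.NavierStokesRegularity.NavierStokesRegularity.Theorems.SelfMixingDichotomyMixingPayoffAdvectionDiffusionSchwartz
import Summits.NavierStokesRegularity.NavierStokesRegularity.Theorems.SelfMixingDichotomyMixingPayoffAdmissibleMinPrinciple
import Summits.NavierStokesRegularity.NavierStokesRegularity.Theorems.SelfMixingDichotomyMixingPayoffMassExportCutoff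
import Summits.NavierStokesRegularity.NavierStokesRegularity.Theorems.SelfMixingDichotomyMixingPayoffTypeIFloorAssembly
import Literature.Analysis.FluidPDE.PassiveScalarEnergyDecay
import HarnessLib

/-!
# Crux `SelfMixingDichotomy.CoherentScaleExclusion` (stmt-NavierStokesRegularity-1423), line
  `registered`: the LOAD FLOOR `stub_loadFloor` — at bounded local Reynolds number nothing `δ`-mixes

Lands `--supports stmt-NavierStokesRegularity-1423` the registered helper stub `stub_loadFloor`
(LF) of the lead's skeleton `Cruxes/CoherentScaleExclusion/Lines/birth.lean`: assuming the `L¹`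
bound (K, landed as `stub_passiveScalarL1Antitone`) for admissible passive scalars, for every
`M₁ > 0` there are `δ₁ = δ₁(M₁) > 0` and `A = A(M₁) ≥ 1` such that for a standing
Navier–Stokes solution (classical on `[0, T)`, Leray–Hopf from a rapidly decaying datum), a point
`x₀` and a scale `r > 0` with `(A r)² < T`, the load bound
`cknC (A r) (T, x₀) u ≤ M₁` (the Caffarelli–Kohn–Nirenberg scaled quantity
`C(ρ) = ρ⁻² ∬_{Q_ρ(T, x₀)} |u|³` at the comparable scale `ρ = A r`) excludes
`DissipatesAtScale u T x₀ r δ₁` (the route's `MIX(u, T, x₀, r, δ₁)`). This is the converse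
direction of the route's kill criterion "`MIX(r, δ)` forces `C ≥ M(δ) → ∞`": coherent
(non-mixing) scales are automatic where the local Reynolds number is bounded.

## Proof

Constants: the absolute cutoff constants `C₁, C₂` of `mexaux_existsCutoff`, `ω = |B₁|`,
`A = 2 + 16 C₂ + 1214 C₁³ M₁/ω`, `δ₁ = 1/(8A²)`. On the window `[t₀, t₁] = [T − r², T − r²/2]`
(inside `[0, T)` as `r² ≤ (A r)² < T`):

1. W (`stub_windowRegularity` + `stub_advectionDiffusionSchwartz`): the drift is jointly smooth
   and bounded on the window, and the bump `φ` (`= 1` on `B̄(x₀, r/2)`, `0 ≤ φ ≤ 1`, supported in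
   `B(x₀, r)`) launches an admissible scalar `θ`; F2 (`stub_admissibleMinPrinciple`): `θ ≥ 0`.
2. Masses: `m = ∫ φ ≥ ω r³/8`, `∫ φ² ≤ m`; `∫ θ(s) ≤ m` (hypothesis K with `θ ≥ 0`);
   `∫ θ(s)² ≤ ∫ φ²` (energy inequality `antitoneOn_integral_sq_of_isDivFree_memLp`).
3. Local duality: with the cutoff `ψ` of `B̄(x₀, A r/2)` (`= 0` and `Dψ = 0` off `B(x₀, A r)`,
   `‖Dψ‖ ≤ 2C₁/(A r)`, `|Δψ| ≤ 4C₂/(A r)²`), `P(s) = ∫ θ(s) ψ` satisfies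
   `P' = ∫ θ (Δψ + Dψ[u])` (`massExport_weightedMass`), `P(t₀) = m`, and pointwise in `s`
   (Young `θ‖u‖ ≤ k³(θ + θ²) + k'³‖u‖³`, `k³ = A/(16 C₁ r)`, `3k²k' = 1`)
   `P'(s) ≥ −K₀ − K₁ ∫_{B(x₀, A r)} ‖u(s)‖³`; both sides are continuous in `s`, so by the
   fundamental theorem of calculus and the load bound
   `∫_{t₀}^{t₁} ∫_{B(x₀, A r)} ‖u‖³ ≤ (A r)² M₁` (Tonelli on the parabolic cylinder,
   `LoadFloor.intervalIntegral_setIntegral_norm_pow_three_le`) one gets `P(t₁) ≥ m − 3m/8`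
   (`2C₂/A² ≤ 1/8`, the Young term is `m/8`, and `512 C₁³ r³ M₁/(27 A) ≤ m/8` by the choice of `A`).
4. Under `MIX(r, δ₁)`: `P(t₁) ≤ 4A³ ∫ θ(t₁)² + ω r³/16 ≤ 4A³ δ₁² m + m/2 ≤ m/16 + m/2`,
   contradicting `m > 0`.

No named fact is taken as a hypothesis beyond the registered premise (K). References:
L. Caffarelli, R. Kohn, L. Nirenberg, CPAM 35 (1982), §2; P. Constantin, A. Kiselev, L. Ryzhik,
A. Zlatoš, Ann. of Math. 168 (2008), §1; A. J. Majda, A. L. Bertozzi, *Vorticity and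
Incompressible Flow* (CUP 2002), §3.1.1.
-/

noncomputable section

open MeasureTheory Set Function Metric Filter Topology
open scoped ContDiff InnerProductSpace Laplacian ENNReal

-- `Summit = Problem` for this summit; the tree lakefile sets `weak.linter.dupNamespace = false`.
set_option linter.dupNamespace false

namespace Summit.NavierStokesRegularity.NavierStokesRegularity.Theorems

open Literature.Analysis.FluidPDE

/-! ### The load floor -/

/-- **Stub LF — the LOAD FLOOR: at bounded local Reynolds number nothing `δ`-mixes.** Assuming the
`L¹` bound (K) for admissible passive scalars in `C¹` divergence-free `L²` drifts
(`∫ |θ(t)| ≤ ∫ |θ(a)|` on the slab), for every `M₁ > 0` there are `δ₁ = δ₁(M₁) > 0` and a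
comparison ratio `A = A(M₁) ≥ 1` such that for every standing Navier–Stokes solution, every
`x₀` and every scale `r > 0` with `(A r)² < T`: if the scaled load
`C(A r) = (A r)⁻² ∬_{Q_{Ar}} |u|³` at `(T, x₀)` is at most `M₁`, then the drift does NOT dissipate
at scale `r` with factor `δ₁`.

Proof. With the absolute cutoff constants `C₁, C₂` (`mexaux_existsCutoff`) and `vB = |B₁|` put
`A = 2 + 16 C₂ + 1214 C₁³ M₁ / vB`, `δ₁ = 1/(8A²)`. Launch `θ` on the window
`[t₀, t₁] = [T − r², T − r²/2]` from the bump `φ` (`= 1` on `B̄(x₀, r/2)`, supported in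
`B(x₀, r)`) by W (`stub_windowRegularity` + `stub_advectionDiffusionSchwartz`); `θ ≥ 0` (F2),
`m = ∫ φ ≥ vB r³/8`, `∫ θ(s) ≤ m` (K), `∫ θ(s)² ≤ ∫ φ² ≤ m` (energy inequality). Test against the
cutoff `ψ` of `B̄(x₀, A r/2)` (`= 0` off `B(x₀, A r)`): `P(s) = ∫ θ(s) ψ` has
`P' = ∫ θ (Δψ + Dψ[u])` (`massExport_weightedMass`), and pointwise in `s`, by
`|Δψ| ≤ 4C₂/(A r)²`, `‖Dψ‖ ≤ 2C₁/(A r)` and the Young inequality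
`θ ‖u‖ ≤ k³(θ + θ²) + k'³ ‖u‖³` (`k³ = A/(16 C₁ r)`, `3k²k' = 1`),
`P' ≥ −K₀ − K₁ ∫_{B(x₀, A r)} ‖u(s)‖³`; integrating (FTC) and using the load
`∫_{t₀}^{t₁} ∫_{B(x₀,Ar)} ‖u‖³ ≤ (A r)² M₁` (Tonelli on the parabolic cylinder) gives
`P(t₁) ≥ m − 3m/8`. On the other hand `P(t₁) ≤ 4A³ ∫ θ(t₁)² + vB r³/16 ≤ 4A³ δ₁² m + m/2 ≤ 9m/16`
under `MIX(r, δ₁)`: contradiction. -/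
theorem stub_loadFloor : (∀ (a b : ℝ), a < b → ∀ (u : ℝ → EuclideanSpace ℝ (Fin 3) → EuclideanSpace ℝ (Fin 3)) (θ : ℝ → EuclideanSpace ℝ (Fin 3) → ℝ), Literature.Analysis.FluidPDE.IsSmoothSpaceTimeOn (Set.Icc a b) θ → Literature.Analysis.FluidPDE.HasUniformRapidDecayOn (Set.Icc a b) θ → (∀ t ∈ Set.Icc a b, ∀ x : EuclideanSpace ℝ (Fin 3), Literature.Analysis.FluidPDE.timeDerivWithin (Set.Icc a b) θ t x + inner ℝ (u t x) (gradient (θ t) x) = Laplacian.laplacian (θ t) x) → (∀ t ∈ Set.Icc a b, ContDiff ℝ 1 (u t)) → (∀ t ∈ Set.Icc a b, Literature.Analysis.FluidPDE.VectorCalculus.IsDivFree (u t)) → (∀ t ∈ Set.Icc a b, MeasureTheory.MemLp (u t) 2 MeasureTheory.volume) → ∀ t ∈ Set.Icc a b, ∫ x, |θ t x| ≤ ∫ x, |θ a x|) → ∀ M₁ : ℝ, 0 < M₁ → ∃ δ₁ : ℝ, 0 < δ₁ ∧ ∃ A : ℝ, 1 ≤ A ∧ ∀ T : ℝ, 0 <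 T → ∀ (u : ℝ → EuclideanSpace ℝ (Fin 3) → EuclideanSpace ℝ (Fin 3)) (p : ℝ → EuclideanSpace ℝ (Fin 3) → ℝ), Literature.Analysis.FluidPDE.IsClassicalNSSolutionOn (Set.Ico 0 T) 1 0 u p → Literature.Analysis.FluidPDE.IsLerayHopfOn T 1 0 (u 0) u → Literature.Analysis.FluidPDE.HasRapidSpatialDecay (u 0) → ∀ (x₀ : EuclideanSpace ℝ (Fin 3)) (r : ℝ), 0 < r → (A * r) ^ 2 < T → Literature.Analysis.FluidPDE.cknC (A * r) ((T, x₀) : ℝ × EuclideanSpace ℝ (Fin 3)) u ≤ ENNReal.ofReal M₁ → ¬ Literature.Analysis.FluidPDE.DissipatesAtScale u T x₀ r δ₁ := by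
  intro hmass M₁ hM₁
  -- absolute constants: the cutoff constants `C₁, C₂` and the unit-ball volume `vB`
  obtain ⟨C₁, C₂, hC₁, hC₂, hcut⟩ := mexaux_existsCutoff
  set vB : ℝ := (volume : Measure (EuclideanSpace ℝ (Fin 3))).real
    (Metric.ball (0 : EuclideanSpace ℝ (Fin 3)) 1) with hvB_def
  have hvB : 0 < vB := by
    rw [hvB_def, measureReal_def]
    exact ENNReal.toReal_pos (measure_ball_pos volume _ one_pos).ne' measure_ball_lt_top.ne
  -- the comparison ratio `A = A(M₁)` and the factor `δ₁ = 1/(8A²)`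
  set A : ℝ := 2 + 16 * C₂ + 1214 * C₁ ^ 3 * M₁ / vB with hA_def
  have hlast : 0 ≤ 1214 * C₁ ^ 3 * M₁ / vB := by positivity
  have hA2 : 2 ≤ A := by rw [hA_def]; nlinarith
  have hA1 : 1 ≤ A := by linarith
  have hA0 : 0 < A := by linarith
  have hAC₂ : 16 * C₂ ≤ A := by rw [hA_def]; linarith
  have hAC₁ : 32768 * C₁ ^ 3 * M₁ ≤ 27 * vB * A := by
    have h1 : 1214 * C₁ ^ 3 * M₁ / vB ≤ A := by rw [hA_def]; nlinarith
    rw [div_le_iff₀ hvB] at h1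
    have : 0 ≤ C₁ ^ 3 * M₁ := by positivity
    nlinarith
  refine ⟨1 / (8 * A ^ 2), by positivity, A, hA1, ?_⟩
  intro T hT u p hcl hLH hdec x₀ r hr hArT hload hmix
  -- the scales: window `[t₀, t₁] = [T - r², T - r²/2] ⊆ [0, T)`
  have hAr : 0 < A * r := mul_pos hA0 hr
  have hr2 : 0 < r ^ 2 := by positivity
  have hr3 : 0 < r ^ 3 := by positivity
  have hA4 : 4 ≤ A ^ 2 := by nlinarith
  have hrAr : r ^ 2 < (A * r) ^ 2 := by
    rw [mul_pow]; nlinarith [mul_le_mul_of_nonneg_right hA4 hr2.le]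
  have hrT : r ^ 2 < T := hrAr.trans hArT
  have hArt₀ : T - (A * r) ^ 2 < T - r ^ 2 := by linarith
  set t₀ : ℝ := T - r ^ 2 with ht₀_def
  set t₁ : ℝ := T - r ^ 2 / 2 with ht₁_def
  have ht₀0 : 0 ≤ t₀ := by rw [ht₀_def]; linarith
  have hab : t₀ < t₁ := by rw [ht₀_def, ht₁_def]; linarith
  have ht₁T : t₁ < T := by rw [ht₁_def]; linarith
  have hdt : t₁ - t₀ = r ^ 2 / 2 := by rw [ht₀_def, ht₁_def]; ring
  have ht₀S : t₀ ∈ Icc t₀ t₁ := ⟨le_rfl, hab.le⟩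
  have ht₁S : t₁ ∈ Icc t₀ t₁ := ⟨hab.le, le_rfl⟩
  have hwin : ∀ t ∈ Icc t₀ t₁, t ∈ Ico 0 T ∧ t ∈ Icc 0 T := fun t ht =>
    ⟨⟨ht₀0.trans ht.1, ht.2.trans_lt ht₁T⟩, ⟨ht₀0.trans ht.1, (ht.2.trans_lt ht₁T).le⟩⟩
  -- W: the drift on the window, and the scalar launched from the bump datum
  obtain ⟨husm, hbds⟩ := stub_windowRegularity T u p hT hcl hLH hdec t₀ t₁ ht₀0 hab ht₁T
  let φ : ContDiffBump x₀ := ⟨r / 2, r, by positivity, by linarith⟩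
  obtain ⟨θ, hsm, hd, hpde, hθ₀⟩ :=
    stub_advectionDiffusionSchwartz t₀ t₁ hab u husm hbds φ φ.contDiff φ.hasCompactSupport
  have hsupp : Function.support (θ t₀) ⊆ Metric.ball x₀ r := by rw [hθ₀, φ.support_eq]
  -- F2: nonnegativity on the window
  have hpos : ∀ t ∈ Icc t₀ t₁, ∀ x : (EuclideanSpace ℝ (Fin 3)), 0 ≤ θ t x :=
    stub_admissibleMinPrinciple T r u θ hr hsm hd hpde (fun x => by rw [hθ₀]; exact φ.nonneg)
  -- slice facts and the bound of the drift on the window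
  have hu1 : ∀ t ∈ Icc t₀ t₁, ContDiff ℝ 1 (u t) := fun t ht =>
    contDiff_infty.1 (hcl.contDiff_velocity (hwin t ht).1) 1
  have hdiv : ∀ t ∈ Icc t₀ t₁, VectorCalculus.IsDivFree (u t) := fun t ht =>
    hcl.divFree t (hwin t ht).1
  have hu2 : ∀ t ∈ Icc t₀ t₁, MemLp (u t) 2 (volume : Measure (EuclideanSpace ℝ (Fin 3))) :=
    fun t ht => hLH.memLp t (hwin t ht).2
  obtain ⟨Mu, hMu⟩ := hbds 0
  have hub : ∀ t ∈ Icc t₀ t₁, ∀ x, ‖u t x‖ ≤ Mu := fun t ht x => by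
    have := hMu t ht x
    rwa [norm_iteratedFDerivWithin_zero] at this
  -- masses: `m = ∫ φ ≥ vB r³/8`, `e₀ = ∫ φ² ≤ m`, `∫ θ(s) ≤ m` (K), `∫ θ(s)² ≤ e₀` (E)
  set m : ℝ := ∫ x, θ t₀ x with hm_def
  set e₀ : ℝ := ∫ x, θ t₀ x ^ 2 with he₀_def
  have hm_lo : (r / 2) ^ 3 * vB ≤ m := by
    rw [hm_def, hθ₀]
    exact LoadFloor.bump_integral_ge φ
  have hm0 : 0 < m := lt_of_lt_of_le (by positivity) hm_lo
  have he₀0 : 0 ≤ e₀ := integral_nonneg fun _ => sq_nonneg _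
  have he₀m : e₀ ≤ m := by
    rw [hm_def, he₀_def, hθ₀]
    exact (LoadFloor.bump_integral_sq_le φ).2
  have hmass_s : ∀ s ∈ Icc t₀ t₁, ∫ x, θ s x ≤ m := by
    intro s hs
    have h := hmass t₀ t₁ hab u θ hsm hd hpde hu1 hdiv hu2 s hs
    have e1 : ∫ x, |θ s x| = ∫ x, θ s x :=
      integral_congr_ae (ae_of_all _ fun x => abs_of_nonneg (hpos s hs x))
    have e2 : ∫ x, |θ t₀ x| = ∫ x, θ t₀ x :=
      integral_congr_ae (ae_of_all _ fun x => abs_of_nonneg (hpos t₀ ht₀S x))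
    rwa [e1, e2] at h
  have henergy : ∀ s ∈ Icc t₀ t₁, ∫ x, θ s x ^ 2 ≤ e₀ := fun s hs =>
    (antitoneOn_integral_sq_of_isDivFree_memLp hab hsm hd hpde hu1 hdiv hu2) ht₀S hs hs.1
  -- the cutoff `ψ` of `B̄(x₀, R)`, `R = A r / 2`, vanishing off `B(x₀, A r)`
  set R : ℝ := A * r / 2 with hR_def
  have hR : 0 < R := by positivity
  have h2R : 2 * R = A * r := by rw [hR_def]; ring
  have hrR : r ≤ R := by rw [hR_def]; nlinarith
  obtain ⟨ψ, hψ2, hψ0, hψ1, hψone, hψzero, hDψzero, hDψ, hΔψ, Mw, hMw⟩ := hcut x₀ R hR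
  have hw0 : ∀ x, ‖ψ x‖ ≤ Mw := fun x => (hMw x).1
  have hw1 : ∀ x, ‖fderiv ℝ ψ x‖ ≤ Mw := fun x => (hMw x).2.1
  have hw2 : ∀ x, ‖fderiv ℝ (fderiv ℝ ψ) x‖ ≤ Mw := fun x => (hMw x).2.2
  -- the cut-off mass `P(s) = ∫ θ(s) ψ`: continuity, production, derivative
  obtain ⟨hPc, hIθ, hIP, hPd⟩ :=
    massExport_weightedMass hab hsm hd hpde hu1 hdiv hub hψ2 hw0 hw1 hw2
  -- the Young constants `k³ = A/(16 C₁ r)`, `k' = 1/(3k²)`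
  obtain ⟨k, hk0, hk3⟩ : ∃ k : ℝ, 0 ≤ k ∧ k ^ 3 = A / (16 * C₁ * r) :=
    ⟨(A / (16 * C₁ * r)) ^ ((3 : ℕ)⁻¹ : ℝ), Real.rpow_nonneg (by positivity) _,
      Real.rpow_inv_natCast_pow (by positivity) three_ne_zero⟩
  have hk3pos : 0 < k ^ 3 := by rw [hk3]; positivity
  have hk : 0 < k := lt_of_le_of_ne hk0 fun h => by rw [← h] at hk3pos; norm_num at hk3pos
  set k' : ℝ := 1 / (3 * k ^ 2) with hk'_def
  have hk' : 0 < k' := by positivity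
  have hkk : 3 * k ^ 2 * k' = 1 := by rw [hk'_def]; field_simp
  have hk'3 : k' ^ 3 = 256 * C₁ ^ 2 * r ^ 2 / (27 * A ^ 2) := by
    have e : k' ^ 3 = 1 / (27 * (k ^ 3) ^ 2) := by rw [hk'_def]; field_simp; ring
    rw [e, hk3]
    field_simp
    ring
  -- the load: `∫_{t₀}^{t₁} ∫_{B(x₀, A r)} ‖u‖³ ≤ (A r)² M₁` (Tonelli on the cylinder)
  have hGload : ∫ s in t₀..t₁, ∫ x in Metric.ball x₀ (A * r), ‖u s x‖ ^ 3 ≤ (A * r) ^ 2 * M₁ :=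
    LoadFloor.intervalIntegral_setIntegral_norm_pow_three_le hAr hM₁.le
      hcl.smooth_velocity.continuousOn (by linarith) hArt₀ hab.le ht₁T hload
  have hG0 : 0 ≤ ∫ s in t₀..t₁, ∫ x in Metric.ball x₀ (A * r), ‖u s x‖ ^ 3 :=
    intervalIntegral.integral_nonneg hab.le fun s _ =>
      integral_nonneg fun x => pow_nonneg (norm_nonneg _) 3
  -- the production bounded below, pointwise in time
  set K₀ : ℝ := C₂ / R ^ 2 * m + C₁ / R * (k ^ 3 * (m + m)) with hK₀_def
  set K₁ : ℝ := C₁ / R * k' ^ 3 with hK₁_def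
  have hK₁ : 0 ≤ K₁ := by positivity
  have hprod : ∀ s ∈ Icc t₀ t₁,
      -K₀ - K₁ * ∫ x in Metric.ball x₀ (A * r), ‖u s x‖ ^ 3 ≤
        ∫ x, θ s x * ((Δ ψ) x + fderiv ℝ ψ x (u s x)) := by
    intro s hs
    have hIθ2 : Integrable (fun x => θ s x ^ 2) := typeIFloor_integrable_sq_slice hsm hd hs
    have hIv3 : IntegrableOn (fun x => ‖u s x‖ ^ 3) (Metric.ball x₀ (2 * R)) :=
      ((((husm.continuous_slice hs).norm.pow 3).continuousOn.integrableOn_compact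
        (isCompact_closedBall x₀ (2 * R))).mono_set ball_subset_closedBall)
    have h := LoadFloor.production_lower_bound (hIP s hs) (hIθ s hs) hIθ2 hIv3 (hpos s hs)
      hDψzero hDψ hΔψ hR hC₁.le hk0 hk'.le hkk
    rw [h2R] at h
    refine le_trans ?_ h
    have i1 := hmass_s s hs
    have i2 := (henergy s hs).trans he₀m
    have hc1 : 0 ≤ C₂ / R ^ 2 := by positivity
    have hc2 : 0 ≤ C₁ / R * k ^ 3 := by positivity
    have j1 := mul_le_mul_of_nonneg_left i1 hc1
    have j2 := mul_le_mul_of_nonneg_left (add_le_add i1 i2) hc2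
    rw [hK₀_def, hK₁_def]
    linarith
  -- continuity in time of the production and of the local cubic norm; FTC
  have hP'c : ContinuousOn (fun s => ∫ x, θ s x * ((Δ ψ) x + fderiv ℝ ψ x (u s x))) (Icc t₀ t₁) :=
    LoadFloor.continuousOn_integral_production hab hsm hd husm hub hψ2 hw1 hw2
  have hGc : ContinuousOn (fun s => ∫ x in Metric.ball x₀ (A * r), ‖u s x‖ ^ 3) (Icc t₀ t₁) :=
    LoadFloor.continuousOn_setIntegral_norm_pow_three husm hub x₀ (A * r)
  have hGi : IntervalIntegrable (fun s => ∫ x in Metric.ball x₀ (A * r), ‖u s x‖ ^ 3) volume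
      t₀ t₁ := hGc.intervalIntegrable_of_Icc hab.le
  have hFTC : ∫ s in t₀..t₁, (∫ x, θ s x * ((Δ ψ) x + fderiv ℝ ψ x (u s x))) =
      (∫ x, θ t₁ x * ψ x) - ∫ x, θ t₀ x * ψ x :=
    intervalIntegral.integral_eq_sub_of_hasDerivAt_of_le hab.le hPc hPd
      (hP'c.intervalIntegrable_of_Icc hab.le)
  have hlowI : ∫ s in t₀..t₁, (-K₀ - K₁ * ∫ x in Metric.ball x₀ (A * r), ‖u s x‖ ^ 3) =
      -K₀ * (t₁ - t₀) - K₁ * ∫ s in t₀..t₁, ∫ x in Metric.ball x₀ (A * r), ‖u s x‖ ^ 3 := by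
    rw [intervalIntegral.integral_sub intervalIntegrable_const (hGi.const_mul K₁),
      intervalIntegral.integral_const, intervalIntegral.integral_const_mul, smul_eq_mul]
    ring
  have hmono : ∫ s in t₀..t₁, (-K₀ - K₁ * ∫ x in Metric.ball x₀ (A * r), ‖u s x‖ ^ 3) ≤
      ∫ s in t₀..t₁, (∫ x, θ s x * ((Δ ψ) x + fderiv ℝ ψ x (u s x))) :=
    intervalIntegral.integral_mono_on hab.le (intervalIntegrable_const.sub (hGi.const_mul K₁))
      (hP'c.intervalIntegrable_of_Icc hab.le) hprod
  -- `P(t₀) = m` and the lower bound `P(t₁) ≥ m - 3m/8`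
  have hP0 : ∫ x, θ t₀ x * ψ x = m := by
    rw [hm_def, hθ₀]
    exact LoadFloor.bump_mul_cutoff_integral φ hrR hψone
  have hX1 : C₂ / R ^ 2 * m * (r ^ 2 / 2) ≤ m / 8 := by
    have e : C₂ / R ^ 2 * m * (r ^ 2 / 2) = 2 * C₂ * m / A ^ 2 := by
      rw [hR_def]; field_simp
    rw [e, div_le_div_iff₀ (by positivity) (by norm_num)]
    have j1 := mul_le_mul_of_nonneg_left hAC₂ hm0.le
    have j2 := mul_le_mul_of_nonneg_left hA1 (by positivity : 0 ≤ A * m)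
    linarith
  have hX2 : C₁ / R * (k ^ 3 * (m + m)) * (r ^ 2 / 2) = m / 8 := by
    rw [hR_def, hk3]; field_simp; ring
  have hX3 : K₁ * ((A * r) ^ 2 * M₁) ≤ m / 8 := by
    have e : K₁ * ((A * r) ^ 2 * M₁) = 512 * C₁ ^ 3 * r ^ 3 * M₁ / (27 * A) := by
      rw [hK₁_def, hR_def, hk'3]; field_simp; ring
    rw [e, div_le_div_iff₀ (by positivity) (by norm_num)]
    have j1 := mul_le_mul_of_nonneg_right hAC₁ hr3.le
    have j2 := mul_le_mul_of_nonneg_left hm_lo (by positivity : (0 : ℝ) ≤ 27 * A)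
    linarith
  have hP1_lo : m - 3 * (m / 8) ≤ ∫ x, θ t₁ x * ψ x := by
    have h1 : -K₀ * (t₁ - t₀) - K₁ * ((A * r) ^ 2 * M₁) ≤ (∫ x, θ t₁ x * ψ x) - m := by
      rw [← hP0, ← hFTC]
      refine le_trans ?_ (hlowI.symm.le.trans hmono)
      have j := mul_le_mul_of_nonneg_left hGload hK₁
      linarith
    have h2 : K₀ * (t₁ - t₀) ≤ m / 8 + m / 8 := by
      rw [hdt, hK₀_def, add_mul]
      linarith [hX1, hX2.le]
    linarith
  -- the upper bound `P(t₁) ≤ 4A³ ∫ θ(t₁)² + vB r³/16 ≤ m/16 + m/2` under `MIX(r, δ₁)`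
  have hIθψ : Integrable (fun x => θ t₁ x * ψ x) :=
    (hIθ t₁ ht₁S).mul_bdd hψ2.continuous.aestronglyMeasurable (ae_of_all _ hw0)
  have hP1_hi := LoadFloor.integral_mul_cutoff_le (L := 8 * A ^ 3) (by positivity) (by positivity)
    hIθψ (typeIFloor_integrable_sq_slice hsm hd ht₁S) hψ0 hψ1 hψzero
  have hMIX : ∫ x, θ t₁ x ^ 2 ≤ (1 / (8 * A ^ 2)) ^ 2 * e₀ := hmix θ hsm hd hpde hsupp
  have hY1 : 8 * A ^ 3 / 2 * ∫ x, θ t₁ x ^ 2 ≤ m / 16 := by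
    have e : 8 * A ^ 3 / 2 * ((1 / (8 * A ^ 2)) ^ 2 * e₀) = e₀ / (16 * A) := by
      field_simp; ring
    refine (mul_le_mul_of_nonneg_left hMIX (by positivity)).trans ?_
    rw [e, div_le_div_iff₀ (by positivity) (by norm_num)]
    have j1 := mul_le_mul_of_nonneg_left hA1 he₀0
    have j2 := mul_le_mul_of_nonneg_right he₀m hA0.le
    linarith
  have hY2 : 1 / (2 * (8 * A ^ 3)) * ((2 * R) ^ 3 * vB) ≤ m / 2 := by
    have e : 1 / (2 * (8 * A ^ 3)) * ((2 * R) ^ 3 * vB) = r ^ 3 * vB / 16 := by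
      rw [hR_def]; field_simp; ring
    rw [e]
    linarith
  linarith [hP1_lo, hP1_hi, hY1, hY2]


end Summit.NavierStokesRegularity.NavierStokesRegularity.Theorems

end
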